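import Summits.QuantumAdvantage.QuantumAdvantage.Theorems.LinnikCubicClassGroupsDegreeOnePrimesEscapeDivisionZeros
import HarnessLib

/-!
# The main term at the exceptional zero: `x − x^{β₁}/β₁ ≫ x |d_N|^{−2(1+n²)}`

Topic `Summits/QuantumAdvantage/QuantumAdvantage/Theorems`, cell B2b-1 (linnik-cubic), PART A (gen 9);
helper toward the crux `DegreeOnePrimesEscape` (stmt-QuantumAdvantage-11543) of route
`LinnikCubicClassGroups`.  HONEST FRAMING: the value of this file is a THEOREM (kernel-checked, no
hypothesis) — NOT summit progress.

`exceptional_mainTerm_ge`: there is `c₁ = c₁(n) ∈ (0, 1]` such that for every Galois number field `N`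
of degree `n > 1` and every real zero `β₁ ∈ [3/4, 1)` of `ζ_N`, for `x > 1` with `log x ≥ 16`:
`x · c₁ / (4 |d_N|^{2(1+n²)}) ≤ x − x^{β₁}/β₁` — Stark's effective bound `1 − β₁ ≥ c₁ Q_N^{−2}`
(`Residue.one_sub_realZero_ge_condQn_rpow`), `x − x^β/β ≥ (x/4) min(1, (1−β) log x)`
(`sub_mul_rpow_div_ge`) and `Q_N ≤ |d_N|^{1+n²}`.
Reference: H. M. Stark, Invent. Math. 23 (1974), Thm. 1′ [Stark1974].
-/

noncomputable section

open scoped NumberField nonZeroDivisors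
open Finset Real Ideal NumberField
open Literature.NumberTheory.NumberFields Literature.NumberTheory.LFunctions
  Literature.NumberTheory.LFunctions.NumberField

namespace Summit.QuantumAdvantage.QuantumAdvantage.Theorems.DegreeOnePrimesEscape

/-- **The main term at the exceptional zero is `≫ x |d_N|^{−2(1+n²)}`** (see the module docstring).
[cite: Stark1974, Theorem 1'] -/
theorem exceptional_mainTerm_ge (n : ℕ) (hn : 1 < n) :
    ∃ c₁ : ℝ, 0 < c₁ ∧ c₁ ≤ 1 ∧ ∀ (N : Type) [Field N] [NumberField N] [IsGalois ℚ N],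
      Module.finrank ℚ N = n → ∀ β₁ : ℝ, dedekindZeta₁ N β₁ = 0 → 3 / 4 ≤ β₁ → β₁ < 1 →
        ∀ x : ℝ, 1 < x → 16 ≤ Real.log x →
          x * c₁ / (4 * ((NumberField.discr N).natAbs : ℝ) ^ (2 * ((1 : ℝ) + n * n))) ≤
            x - x ^ β₁ / β₁ := by
  obtain ⟨c₁, hc₁, hc₁1, heff⟩ := Residue.one_sub_realZero_ge_condQn_rpow n hn
  refine ⟨c₁, hc₁, hc₁1, fun N _ _ _ hN β₁ hζ₁ hβ34 hβ₁1 x hx1 hx16 => ?_⟩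
  have hN1 : 1 < Module.finrank ℚ N := by rw [hN]; exact hn
  set d : ℝ := ((NumberField.discr N).natAbs : ℝ) with hd
  set e : ℝ := (1 : ℝ) + n * n with he
  have hd3 : (3 : ℝ) ≤ d := three_le_natAbs_discr_real N hN1
  have hd0 : (0 : ℝ) < d := by linarith
  have hx0 : 0 < x := by linarith
  have hβne : (β₁ : ℂ) ≠ 1 := fun h => hβ₁1.ne (by exact_mod_cast h)
  -- `Q_N ≤ d^e`
  have hQN : ThornerZaman.condQn N ≤ d ^ e := by
    have h1 : ThornerZaman.condQn N = d * (n : ℝ) ^ n := by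
      rw [hd, ThornerZaman.condQn, hN, ← Int.cast_abs, Int.abs_eq_natAbs, Int.cast_natCast]
    have h2 : d ^ e = d * d ^ (n * n) := by
      rw [he, show (1 : ℝ) + n * n = (((1 + n * n : ℕ)) : ℝ) by push_cast; ring, Real.rpow_natCast,
        pow_add, pow_one]
    rw [h1, h2]
    exact mul_le_mul_of_nonneg_left (pow_self_le_rpow_sq le_rfl hd3) hd0.le
  have hQ12 : (12 : ℝ) ≤ ThornerZaman.condQn N := ThornerZaman.twelve_le_condQn (K := N) hN1
  -- Stark: `c₁ Q_N^{−2} ≤ 1 − β₁`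
  have hLz : classGroupLFunction N 1 β₁ = 0 := by
    rw [classGroupLFunction_one N hβne]; exact (dedekindZeta₁_eq_zero_iff hβne).mp hζ₁
  have hδ : c₁ * ThornerZaman.condQn N ^ (-(2 : ℝ)) ≤ 1 - β₁ :=
    heff N hN 1 (mul_one (1 : ClassGroup (𝓞 N) →* ℂˣ)) β₁ hβ₁1 hLz
  have hQm2 : ThornerZaman.condQn N ^ (-(2 : ℝ)) ≤ 1 :=
    Real.rpow_le_one_of_one_le_of_nonpos (by linarith) (by norm_num)
  have hQm2' : 0 ≤ ThornerZaman.condQn N ^ (-(2 : ℝ)) := Real.rpow_nonneg (by linarith) _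
  have hMge : x / 4 * min 1 ((1 - β₁) * Real.log x) ≤ x - x ^ β₁ / β₁ := by
    have := sub_mul_rpow_div_ge (r := 1) hx1 hx16 hβ34 hβ₁1 (by norm_num)
    rwa [one_mul] at this
  have hMlow : x / 4 * (c₁ * ThornerZaman.condQn N ^ (-(2 : ℝ))) ≤ x - x ^ β₁ / β₁ :=
    mainTerm_ge_of_stark hx0.le hMge hδ hc₁1 hc₁.le hQm2 hQm2' (by linarith)
  have hQinv : (d ^ (2 * e))⁻¹ ≤ ThornerZaman.condQn N ^ (-(2 : ℝ)) := by
    rw [Real.rpow_neg (by linarith), show (2 : ℝ) * e = e * 2 by ring, Real.rpow_mul hd0.le]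
    exact inv_anti₀ (by positivity) (Real.rpow_le_rpow (by linarith) hQN (by norm_num))
  have hde0 : 0 < d ^ (2 * e) := by positivity
  calc x * c₁ / (4 * d ^ (2 * e)) = x / 4 * (c₁ * (d ^ (2 * e))⁻¹) := by field_simp
    _ ≤ x / 4 * (c₁ * ThornerZaman.condQn N ^ (-(2 : ℝ))) :=
        mul_le_mul_of_nonneg_left (mul_le_mul_of_nonneg_left hQinv hc₁.le) (by positivity)
    _ ≤ x - x ^ β₁ / β₁ := hMlow

end Summit.QuantumAdvantage.QuantumAdvantage.Theorems.DegreeOnePrimesEscape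

end
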